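import Summits.CriticalPhenomena.PercolationContinuityZ3.Theorems.PercNearOneGluingNoHeavyLowerTailQ7PsiMonotone
import HarnessLib

/-!
# `NoHeavyLowerTail` (stmt-CriticalPhenomena-4575) — a mixed form of Kozma–Nitzan's Lemma 3 for real
# cluster properties (decreasing event of the weak cluster × increasing event of the strong cluster)

Support file (`--supports stmt-CriticalPhenomena-4575`), coupling seat `prim-cplus-coupling` (gen 5).  No
definitions, no named facts, no sorries.

* `Q7Psi.lemma3_mixed_real` — `F` monotone on vertex sets, `E F(C(a₁)) ≤ E F(C(a₂))` (`a₁` weak, `a₂` strong),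
  `𝒬₁` a LOWER family (so `Q₁ = {C_{a₁} ∈ 𝒬₁}` is decreasing in the cluster of `a₁`), `𝒬₂` an UPPER family
  (`Q₂ = {C_{a₂} ∈ 𝒬₂}` increasing in the cluster of `a₂`).  Then
  `∫_{Q₁ ∩ Q₂} F(C(a₁)) ≤ ∫_{Q₁ ∩ Q₂} F(C(a₂))`.
  Kozma–Nitzan's Lemma 3 (arXiv:2401.12397, pp. 6–7; real form §5.1) is the two special cases `𝒬₂ = ⊤` (ii) and
  `𝒬₁ = ⊤` (i) (`KozmaNitzan2024_lemma3_ii_real`, `Q7Psi.lemma3_i_real`).  Proof: on `{a₁ ↔ a₂}` the clusters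
  coincide; on `D = {a₁ ↮ a₂}` two applications of van den Berg–Häggström–Kahn's Theorem 1.5
  (`BHK2006_twoClusterConditionalAssociation_holds`): with `(s,t) = (a₁,a₂)` for the pair
  `(F(C a₁), −𝟙_{Q₁}𝟙_{Q₂})` and with `(s,t) = (a₂,a₁)` for `(F(C a₂), 𝟙_{Q₂}𝟙_{Q₁})`, both pairs being
  increasing in `C_s` and decreasing in `C_t`.  (Seat memo A5-COUPLING-gen5.md §14; a tool for star arguments
  at observers with non-relay neighbours.)
[cite: KozmaNitzan2024, Lemma 3 (pp. 6–7), §5.1 (pp. 31–32)] [cite: VandenbergHaggstromKahn2005, Thm. 1.5 (p. 7)]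
-/

namespace Summit.CriticalPhenomena.PercolationContinuityZ3.Theorems

open MeasureTheory Set Literature.Probability.LatticeModels Literature.Probability.Percolation
open scoped Classical
open KNPreFKG

noncomputable section

namespace Q7Psi

variable {V : Type*} [Fintype V]

/-- **Mixed Lemma 3**: weak-cluster decreasing event times strong-cluster increasing event.
[cite: KozmaNitzan2024, Lemma 3 (pp. 6–7), §5.1 (pp. 31–32)] [cite: VandenbergHaggstromKahn2005, Thm. 1.5 (p. 7)] -/
theorem lemma3_mixed_real (w : Sym2 V → unitInterval) (a₁ a₂ : V) (F : Set V → ℝ)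
    (hF : ∀ S T : Set V, S ⊆ T → F S ≤ F T)
    (h : ∫ ω, F (openCluster ω a₁) ∂(prodBernoulli w) ≤ ∫ ω, F (openCluster ω a₂) ∂(prodBernoulli w))
    {𝒬₁ 𝒬₂ : Set (Set (Sym2 V))} (h𝒬₁ : IsLowerSet 𝒬₁) (h𝒬₂ : IsUpperSet 𝒬₂) :
    ∫ ω in {ω | openEdgeCluster ω a₁ ∈ 𝒬₁} ∩ {ω | openEdgeCluster ω a₂ ∈ 𝒬₂}, F (openCluster ω a₁) ∂(prodBernoulli w) ≤
      ∫ ω in {ω | openEdgeCluster ω a₁ ∈ 𝒬₁} ∩ {ω | openEdgeCluster ω a₂ ∈ 𝒬₂}, F (openCluster ω a₂)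
        ∂(prodBernoulli w) := by
  classical
  set μ := prodBernoulli w with hμ
  by_cases h12 : a₁ = a₂
  · subst h12
    exact le_rfl
  set f₁ : BondConfig V → ℝ := fun ω => F (openCluster ω a₁) with hf₁
  set f₂ : BondConfig V → ℝ := fun ω => F (openCluster ω a₂) with hf₂
  set Q₁ : Set (BondConfig V) := {ω | openEdgeCluster ω a₁ ∈ 𝒬₁} with hQ₁
  set Q₂ : Set (BondConfig V) := {ω | openEdgeCluster ω a₂ ∈ 𝒬₂} with hQ₂
  set Q : Set (BondConfig V) := Q₁ ∩ Q₂ with hQ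
  set D : Set (BondConfig V) := {ω | ¬ (openGraph ω).Reachable a₁ a₂} with hD
  have hmeas : ∀ S : Set (BondConfig V), MeasurableSet S := fun _ => MeasurableSet.of_discrete
  have hint : ∀ (g : BondConfig V → ℝ) (S : Set (BondConfig V)), IntegrableOn g S μ :=
    fun g S => (Integrable.of_finite).integrableOn
  -- on `Dᶜ` the two clusters coincide
  have hagree : ∀ ω, ω ∉ D → f₁ ω = f₂ ω := by
    intro ω hω
    have hr : (openGraph ω).Reachable a₁ a₂ := by
      by_contra hc
      exact hω hc
    simp only [hf₁, hf₂]
    rw [openCluster_eq_of_reachable hr]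
  have hsplit : ∀ (g : BondConfig V → ℝ) (S : Set (BondConfig V)),
      ∫ ω in S, g ω ∂μ = ∫ ω in S ∩ D, g ω ∂μ + ∫ ω in S \ D, g ω ∂μ := by
    intro g S
    rw [integral_inter_add_sdiff (hmeas D) (hint g S)]
  have hdiff : ∀ S : Set (BondConfig V), ∫ ω in S \ D, f₁ ω ∂μ = ∫ ω in S \ D, f₂ ω ∂μ := by
    intro S
    refine setIntegral_congr_fun ((hmeas S).diff (hmeas D)) fun ω hω => ?_
    exact hagree ω hω.2
  -- the hypothesis restricted to `D`
  have hH : ∫ ω in D, f₁ ω ∂μ ≤ ∫ ω in D, f₂ ω ∂μ := by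
    have e1 := integral_add_compl (hmeas D) (Integrable.of_finite : Integrable f₁ μ)
    have e2 := integral_add_compl (hmeas D) (Integrable.of_finite : Integrable f₂ μ)
    have e3 : ∫ ω in Dᶜ, f₁ ω ∂μ = ∫ ω in Dᶜ, f₂ ω ∂μ :=
      setIntegral_congr_fun (hmeas D).compl fun ω hω => hagree ω hω
    have h' : ∫ ω, f₁ ω ∂μ ≤ ∫ ω, f₂ ω ∂μ := h
    linarith
  have hind₁ : ∀ ω : BondConfig V, 𝒬₁.indicator (1 : Set (Sym2 V) → ℝ) (openEdgeCluster ω a₁) =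
      Q₁.indicator (1 : BondConfig V → ℝ) ω := fun ω => congrFun (indicator_comp_openEdgeCluster 𝒬₁ a₁) ω
  have hind₂ : ∀ ω : BondConfig V, 𝒬₂.indicator (1 : Set (Sym2 V) → ℝ) (openEdgeCluster ω a₂) =
      Q₂.indicator (1 : BondConfig V → ℝ) ω := fun ω => congrFun (indicator_comp_openEdgeCluster 𝒬₂ a₂) ω
  have hprod : ∀ ω : BondConfig V, Q₁.indicator (1 : BondConfig V → ℝ) ω * Q₂.indicator (1 : BondConfig V → ℝ) ω =
      Q.indicator (1 : BondConfig V → ℝ) ω := by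
    intro ω
    rw [hQ, inter_indicator_one]
    rfl
  -- (1) BHK Thm. 1.5 with `(s,t) = (a₁,a₂)`: `F(C a₁)` (increasing in `C_{a₁}`) and `-𝟙_{Q₁}(C_{a₁}) 𝟙_{Q₂}(C_{a₂})`
  --     (increasing in `C_{a₁}`, decreasing in `C_{a₂}`)
  have h1 := BHK2006_twoClusterConditionalAssociation_holds V w a₁ a₂
    (fun C _ => F {a | a = a₁ ∨ ∃ e ∈ C, a ∈ e})
    (fun C D' => - (𝒬₁.indicator (1 : Set (Sym2 V) → ℝ) C * 𝒬₂.indicator (1 : Set (Sym2 V) → ℝ) D'))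
    (fun _ => monotone_clusterFun a₁ F hF) (fun _ => antitone_const)
    (fun D' C C' hCC' => by
      simp only [neg_le_neg_iff]
      exact mul_le_mul_of_nonneg_right (antitone_indicator_one_of_isLowerSet h𝒬₁ hCC')
        (indicator_nonneg (fun _ _ => zero_le_one) _))
    (fun C D' D'' hDD' => by
      simp only [neg_le_neg_iff]
      exact mul_le_mul_of_nonneg_left (monotone_indicator_one_of_isUpperSet h𝒬₂ hDD')
        (indicator_nonneg (fun _ _ => zero_le_one) _)) h12
  simp only [clusterFun_openEdgeCluster, hind₁, hind₂, hprod, mul_neg, integral_neg] at h1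
  rw [setIntegral_indicator_one_eq, setIntegral_mul_indicator_one] at h1
  change -((∫ ω in D, f₁ ω ∂μ) * μ.real (D ∩ Q)) ≤ -(μ.real D * ∫ ω in D ∩ Q, f₁ ω ∂μ) at h1
  -- (2) BHK Thm. 1.5 with `(s,t) = (a₂,a₁)`: `F(C a₂)` and `𝟙_{Q₂}(C_{a₂}) 𝟙_{Q₁}(C_{a₁})`
  have hD2 : {ω : BondConfig V | ¬ (openGraph ω).Reachable a₂ a₁} = D := by
    ext ω
    simp only [mem_setOf_eq, hD]
    exact not_congr ⟨SimpleGraph.Reachable.symm, SimpleGraph.Reachable.symm⟩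
  have h3 := BHK2006_twoClusterConditionalAssociation_holds V w a₂ a₁
    (fun C _ => F {a | a = a₂ ∨ ∃ e ∈ C, a ∈ e})
    (fun C D' => 𝒬₂.indicator (1 : Set (Sym2 V) → ℝ) C * 𝒬₁.indicator (1 : Set (Sym2 V) → ℝ) D')
    (fun _ => monotone_clusterFun a₂ F hF) (fun _ => antitone_const)
    (fun D' C C' hCC' => mul_le_mul_of_nonneg_right (monotone_indicator_one_of_isUpperSet h𝒬₂ hCC')
        (indicator_nonneg (fun _ _ => zero_le_one) _))
    (fun C D' D'' hDD' => mul_le_mul_of_nonneg_left (antitone_indicator_one_of_isLowerSet h𝒬₁ hDD')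
        (indicator_nonneg (fun _ _ => zero_le_one) _)) (Ne.symm h12)
  have hprod' : ∀ ω : BondConfig V, Q₂.indicator (1 : BondConfig V → ℝ) ω * Q₁.indicator (1 : BondConfig V → ℝ) ω =
      Q.indicator (1 : BondConfig V → ℝ) ω := fun ω => by rw [mul_comm]; exact hprod ω
  simp only [hD2, clusterFun_openEdgeCluster, hind₁, hind₂, hprod'] at h3
  rw [setIntegral_indicator_one_eq, setIntegral_mul_indicator_one] at h3
  change (∫ ω in D, f₂ ω ∂μ) * μ.real (D ∩ Q) ≤ μ.real D * ∫ ω in D ∩ Q, f₂ ω ∂μ at h3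
  have hcore : ∫ ω in D ∩ Q, f₁ ω ∂μ ≤ ∫ ω in D ∩ Q, f₂ ω ∂μ := by
    by_cases hD0 : μ.real D = 0
    · have hDQ0 : μ (D ∩ Q) = 0 := by
        have : μ.real (D ∩ Q) = 0 :=
          le_antisymm ((measureReal_mono inter_subset_left).trans hD0.le) measureReal_nonneg
        exact (measureReal_eq_zero_iff (measure_ne_top _ _)).1 this
      rw [setIntegral_measure_zero _ hDQ0, setIntegral_measure_zero _ hDQ0]
    · have hDpos : 0 < μ.real D := lt_of_le_of_ne measureReal_nonneg (Ne.symm hD0)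
      have hDQ : 0 ≤ μ.real (D ∩ Q) := measureReal_nonneg
      have hchain : μ.real D * ∫ ω in D ∩ Q, f₁ ω ∂μ ≤ μ.real D * ∫ ω in D ∩ Q, f₂ ω ∂μ :=
        calc μ.real D * ∫ ω in D ∩ Q, f₁ ω ∂μ ≤ (∫ ω in D, f₁ ω ∂μ) * μ.real (D ∩ Q) := by linarith
          _ ≤ (∫ ω in D, f₂ ω ∂μ) * μ.real (D ∩ Q) := mul_le_mul_of_nonneg_right hH hDQ
          _ ≤ μ.real D * ∫ ω in D ∩ Q, f₂ ω ∂μ := h3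
      exact le_of_mul_le_mul_left hchain hDpos
  show ∫ ω in Q, f₁ ω ∂μ ≤ ∫ ω in Q, f₂ ω ∂μ
  rw [hsplit f₁ Q, hsplit f₂ Q, inter_comm Q D, hdiff Q]
  linarith [hcore]

end Q7Psi

end

end Summit.CriticalPhenomena.PercolationContinuityZ3.Theorems
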